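import Summits.AtomisticToContinuum.FouriersLaw.Theses.EmbeddedDrudeMourre
import Summits.AtomisticToContinuum.FouriersLaw.Theses.KineticCorner
import Summits.AtomisticToContinuum.FouriersLaw.Theorems.EmbeddedDrudeMourreMourreDissolutionFrameworkReduction
import Summits.AtomisticToContinuum.FouriersLaw.Theorems.EmbeddedDrudeMourreMourreDissolutionGibbsClustering
import Summits.AtomisticToContinuum.FouriersLaw.Theorems.EmbeddedDrudeMourreDrudeDissolutionReduction
import HarnessLib

/-!
# The crux `MourreDissolution` (and the target `DrudeDissolution`) from the kinetic-corner Green–Kubo law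
# (`--supports` stmt-AtomisticToContinuum-12594; line `separable-vertex-faddeev-pair-sector`, lead c2)

Item `stmt-AtomisticToContinuum-12594` (crux `MourreDissolution` of route `EmbeddedDrudeMourre`, sub-problem
`FouriersLaw`; equivalent to the route's target `DrudeDissolution`, stmt-12593, by the landed
`drudeDissolution_iff_mourreDissolution`). The route's target is "stated on `C_T` alone so that KineticCorner's
time-domain engine may also reach it" (planner, docstring of `DrudeDissolution`). This file TYPES that reach: the
target `KineticCornerGreenKubo` of the sibling regime route `KineticCorner` (stmt-AtomisticToContinuum-3429; its
clause (ii): on a corner `T < T₁(e)` EVERY good triple `(T, μ, D)` — DLR state at `T`, `μ`-preserving dynamics,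
absolutely convergent and locally integrable summed current correlations, `μ` shift-invariant, flow shift-covariant —
has `C_T ∈ L¹(0,∞)`, `κ_GK > 0` and `|T²κ_GK − c| ≤ e`) IMPLIES `DrudeDissolution`, hence `MourreDissolution`:

* `canonicalDatum` — the CANONICAL symmetric Buttà–Marchioro dynamics of `pinnedChain ω₂ lam β γ` (carrier `bmGood`,
  identity off `bmGood`, hence commuting with the lattice translations EVERYWHERE, `exists_symmetric_bmDynamics`)
  carries at every `T > 0` a zero-wavenumber datum `Z` whose state is DLR-Gibbs at `T`, superstable,
  momentum-reversal symmetric, with strongly continuous Koopman group — the landed Gibbs/clustering stub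
  `stub_gibbsClustering` (S1′ of this line, p108779) fed through the landed assembly
  `exists_zeroWavenumberData_of_clustering` (same proof as `symmetricFramework_of_clustering`, keeping the exact
  shift covariance the good-triple bundle asks for);
* `goodTriple_of_canonicalDatum` — `(T, Z.μ, D)` is a good triple in the sense of route KineticCorner (six clauses;
  `C_T` is continuous, `regular_of_zeroWavenumberData`);
* `drudeDissolution_of_kineticCornerGreenKubo` — clause (ii) with `e = c/2` gives `C_T ∈ L¹(0,∞)` and
  `0 < ∫₀^∞ C_T`; `C_T` is continuous, even, of positive type, so the landed cosine-Bochner theorem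
  (`stub_cosineBochner`, S2) and the landed integrable-spectral criterion (`stub_integrableSpectralCriterion`, line
  Sketch of stmt-12593: an integrable cosine transform has a continuous window density with `g(0) = π⁻¹∫₀^∞ C_T > 0`)
  produce the dissolved Drude atom; `mourreDissolution_of_kineticCornerGreenKubo` is the weakening.

The hypothesis is the route decl `Summit.AtomisticToContinuum.FouriersLaw.Theses.KineticCorner.KineticCornerGreenKubo`
BY NAME (so `KineticCornerGreenKubo_holds`, when it exists, applies verbatim). CONDITIONAL result: it closes nothing by itself (stmt-3429 is open; by `TargetGlue` it is `PostKineticTail ∧ KineticLimit ∧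
StationaryCorrelationBound ∧ GoodFamilyExists`). What it records for the planners: the crux of THIS route is implied by
the regime deliverable of route KineticCorner — integrable decay of `C_T` is a stronger conclusion than continuity of the
spectral density at `0` — independently of the open odd-sector Mourre estimate (S5) of this line.
-/

noncomputable section

open MeasureTheory Filter Set Function
open scoped Topology

namespace Summit.AtomisticToContinuum.FouriersLaw.Theorems.MourreDissolution

open Literature.MathematicalPhysics.KineticTheory.HeatConduction

/-- **The canonical zero-wavenumber datum with exact translation covariance.** For `pinnedChain ω₂ lam β γ`
(`ω₂, lam, β > 0`): ONE infinite-volume dynamics `D` with `D.carrier = bmGood` whose flow commutes with every lattice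
translation EVERYWHERE (`φ_t ∘ τ_x = τ_x ∘ φ_t` as functions), and for every `T > 0` a zero-wavenumber datum `Z` over `D`
whose state is a DLR Gibbs state at `T` with the superstability estimate, momentum-reversal symmetric, with strongly
continuous Koopman group. Proof: the canonical symmetric Buttà–Marchioro dynamics (`exists_symmetric_bmDynamics`), the
landed Gibbs/clustering statement `stub_gibbsClustering` and the assembly `exists_zeroWavenumberData_of_clustering`
(verbatim the proof of `symmetricFramework_of_clustering`, which forgets the covariance). [folklore] -/
theorem canonicalDatum (ω₂ lam β γ : ℝ) (hω : 0 < ω₂) (hl : 0 < lam) (hβ : 0 < β) :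
    ∃ D : InfiniteChainDynamics (pinnedChain ω₂ lam β γ),
      D.carrier = (pinnedChain ω₂ lam β γ).bmGood ∧
      (∀ (t : ℝ) (x : ℤ), D.flow t ∘ chainShift x = chainShift x ∘ D.flow t) ∧
      ∀ T : ℝ, 0 < T →
        ∃ Z : ZeroWavenumberData (pinnedChain ω₂ lam β γ) D,
          (pinnedChain ω₂ lam β γ).IsChainGibbsMeasure T Z.μ ∧
          (pinnedChain ω₂ lam β γ).HasSuperstabilityEstimate Z.μ ∧
          Z.HasMomentumReversal ∧
          (∀ ψ : ZeroWavenumberSpace Z, Continuous fun t : ℝ => Z.koopman t ψ) := by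
  obtain ⟨D, hD, hm, hid, hgrp, hpresAll, hsh, hrev, hrefl⟩ :=
    exists_symmetric_bmDynamics ω₂ lam β γ hω.le hl hβ
  refine ⟨D, hD, hsh, fun T hT => ?_⟩
  obtain ⟨μ, hG, hshift, hSS, hιmap, hsum, hcont⟩ :=
    stub_gibbsClustering ω₂ lam β γ hω hl hβ T hT D hD hm hid
  haveI := hG.isProbabilityMeasure
  have hpres : D.PreservesMeasure μ := hpresAll T μ hG hSS
  -- global `φ_0 = id` and group law (identity off `bmGood`)
  have h0 : D.flow 0 = id := by
    funext σ
    by_cases hσ : σ ∈ (pinnedChain ω₂ lam β γ).bmGood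
    · exact D.flow_zero σ (by rw [hD]; exact hσ)
    · exact hid 0 σ hσ
  have hgrp' : ∀ t s : ℝ, D.flow (t + s) = D.flow t ∘ D.flow s := by
    intro t s
    funext σ
    by_cases hσ : σ ∈ (pinnedChain ω₂ lam β γ).bmGood
    · exact hgrp t s σ hσ
    · rw [comp_apply, hid (t + s) σ hσ, hid s σ hσ, hid t σ hσ]
  obtain ⟨Z, hZμ, hMR, -, -, hsc⟩ :=
    exists_zeroWavenumberData_of_clustering _ D (pinnedChain_V_neg ω₂ lam β γ) h0 hgrp' hsh hrev
      hrefl μ hpres (hshift.measurePreserving_chainShift)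
      (measurePreserving_chainReversal_of_isChainGibbsMeasure hG)
      (OscillatorChain.memLp_bondCurrentZ_pinnedChain γ hω.le hl.le hβ hSS 0 (by norm_num))
      (OscillatorChain.memLp_energyDensityZ_pinnedChain γ hω.le hl.le hβ.le hSS 0 (by norm_num))
      hsum hcont
  exact ⟨Z, by rw [hZμ]; exact hG, by rw [hZμ]; exact hSS, hMR, hsc⟩

/-- **The canonical datum is a good triple** in the sense of route KineticCorner: for `D` commuting with the
translations everywhere and a zero-wavenumber datum `Z` over `D` whose state is DLR at `T` with strongly continuous
Koopman group, `(T, Z.μ, D)` satisfies the six-clause bundle — DLR, `Z.μ`-preserving, absolutely convergent summed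
current correlations at every time, `C_T` locally integrable (it is continuous), `Z.μ` invariant under the unit shift,
flow shift-covariant. [folklore] -/
theorem goodTriple_of_canonicalDatum {ω₂ lam β γ T : ℝ}
    {D : InfiniteChainDynamics (pinnedChain ω₂ lam β γ)}
    (hsh : ∀ (t : ℝ) (x : ℤ), D.flow t ∘ chainShift x = chainShift x ∘ D.flow t)
    (Z : ZeroWavenumberData (pinnedChain ω₂ lam β γ) D)
    (hG : (pinnedChain ω₂ lam β γ).IsChainGibbsMeasure T Z.μ)
    (hsc : ∀ ψ : ZeroWavenumberSpace Z, Continuous fun t : ℝ => Z.koopman t ψ) :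
    (pinnedChain ω₂ lam β γ).IsChainGibbsMeasure T Z.μ ∧ D.PreservesMeasure Z.μ ∧
      (∀ t : ℝ, D.HasAbsConvergentCorrelation Z.μ t) ∧
      (∀ S : ℝ, IntegrableOn (D.currentCorrelation Z.μ) (Set.Icc 0 S)) ∧
      MeasurePreserving (fun σ : ChainConfig => fun i : ℤ => σ (i + 1)) Z.μ Z.μ ∧
      (∀ (t : ℝ) (σ : ChainConfig), D.flow t (fun i : ℤ => σ (i + 1)) = fun i : ℤ => D.flow t σ (i + 1)) := by
  obtain ⟨hP, hA, hcont, -, -⟩ := DrudeDissolution.LineSketch.regular_of_zeroWavenumberData Z hG hsc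
  refine ⟨hG, hP, hA, fun S => hcont.integrableOn_Icc, ?_, fun t σ => ?_⟩
  · have e : (fun σ : ChainConfig => fun i : ℤ => σ (i + 1)) = fun σ => chainShift 1 σ := by
      funext σ i
      simp only [chainShift_apply]
    rw [e]
    exact Z.measurePreserving_shift 1
  · have h := congrFun (hsh t 1) σ
    simp only [comp_apply] at h
    have e1 : (chainShift 1 σ : ChainConfig) = fun i : ℤ => σ (i + 1) := by
      funext i; simp only [chainShift_apply]
    have e2 : (chainShift 1 (D.flow t σ) : ChainConfig) = fun i : ℤ => D.flow t σ (i + 1) := by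
      funext i; simp only [chainShift_apply]
    rw [e1, e2] at h
    exact h

/-- **`DrudeDissolution ⇐ KineticCornerGreenKubo`.** If the kinetic-corner Green–Kubo law holds (the body of
`Theses.KineticCorner.KineticCornerGreenKubo`, stmt-AtomisticToContinuum-3429, verbatim: `∃ c > 0`, (i) some
Green–Kubo pair on a corner, (ii) every good triple with `T < T₁(e)` has `HasGreenKubo` and `|T²κ_GK − c| ≤ e`), then
the dissolved-Drude-atom statement `DrudeDissolution` (stmt-12593) holds: with `T₀ := T₁(c/2)` and, at `T < T₀`, the
canonical datum `(Z.μ, D)` of `canonicalDatum`, clause (ii) gives `C_T ∈ L¹(0,∞)` and `κ_GK > 0`, i.e.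
`0 < ∫₀^∞ C_T`; `C_T` being continuous, even and of positive type (`regular_of_zeroWavenumberData`), the cosine-Bochner
theorem (`stub_cosineBochner`) and the integrable-spectral criterion (`stub_integrableSpectralCriterion`) give the finite
spectral measure with a continuous window density, positive at `0`. CONDITIONAL (stmt-3429 open). [folklore] -/
theorem drudeDissolution_of_kineticCornerGreenKubo :
    Summit.AtomisticToContinuum.FouriersLaw.Theses.KineticCorner.KineticCornerGreenKubo →
      Summit.AtomisticToContinuum.FouriersLaw.Theses.EmbeddedDrudeMourre.DrudeDissolution := by
  intro hK ω₂ lam β γ hω hl hβ hγ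
  obtain ⟨c, T₀, hc, -, -, hii⟩ := hK ω₂ lam β γ hω hl hβ hγ
  obtain ⟨T₁, hT₁, hgood⟩ := hii (c / 2) (by positivity)
  obtain ⟨D, -, hsh, hZ⟩ := canonicalDatum ω₂ lam β γ hω hl hβ
  refine ⟨T₁, hT₁, fun T hT hTlt => ?_⟩
  obtain ⟨Z, hG, -, -, hsc⟩ := hZ T hT
  obtain ⟨hP, hA, hcont, heven, hpsd⟩ := DrudeDissolution.LineSketch.regular_of_zeroWavenumberData Z hG hsc
  obtain ⟨⟨-, hint, hκ⟩, -⟩ := hgood T Z.μ D hT hTlt (goodTriple_of_canonicalDatum hsh Z hG hsc)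
  have hpos : 0 < ∫ t in Set.Ioi (0 : ℝ), D.currentCorrelation Z.μ t := by
    unfold InfiniteChainDynamics.greenKuboConductivity at hκ
    have hT2 : 0 < (T ^ 2)⁻¹ := by positivity
    by_contra h
    have := mul_nonpos_of_nonneg_of_nonpos hT2.le (not_lt.mp h)
    linarith
  obtain ⟨σ, hσ, hC⟩ := stub_cosineBochner _ hcont heven hpsd
  obtain ⟨σ', hσ', hC', δ, g, hδ, hg, hg0, hgpos, hres⟩ :=
    DrudeDissolution.LineSketch.stub_integrableSpectralCriterion σ _ hσ hC hint hpos
  exact ⟨Z.μ, D, hG, hP, hA, σ', hσ', hC', δ, g, hδ, hg, hg0, hgpos, hres⟩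

/-- **`MourreDissolution ⇐ KineticCornerGreenKubo`** (the crux of this line's item, stmt-AtomisticToContinuum-12594,
from the target of route KineticCorner, stmt-3429): weakening of `drudeDissolution_of_kineticCornerGreenKubo` by the
unused gap hypothesis. CONDITIONAL (stmt-3429 open); records that the crux is implied by the regime deliverable of the
sibling route independently of the open odd-sector Mourre estimate `stub_oddSectorMourreEstimate`. [folklore] -/
theorem mourreDissolution_of_kineticCornerGreenKubo :
    Summit.AtomisticToContinuum.FouriersLaw.Theses.KineticCorner.KineticCornerGreenKubo →
      Summit.AtomisticToContinuum.FouriersLaw.Theses.EmbeddedDrudeMourre.MourreDissolution :=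
  fun hK ω₂ lam β γ hω hl hβ hγ _ => drudeDissolution_of_kineticCornerGreenKubo hK ω₂ lam β γ hω hl hβ hγ

end Summit.AtomisticToContinuum.FouriersLaw.Theorems.MourreDissolution

end
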